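import Mathlib.Analysis.SumIntegralComparisons
import Mathlib.Analysis.SpecialFunctions.Integrals.Basic
import Mathlib.Data.ZMod.ValMinAbs
import HarnessLib

/-!
# One-dimensional lattice sums of inverse-quadratic weights on `ℤ/nℤ`: `Σ_x (1 + (s|x̃|)²)⁻¹ ≤ 2 + π/s`

Topic `Literature/Probability/LatticeModels`; the elementary geometry-of-the-weight input of `TorusFourierWeightedL1ProdWeight.lean`
(`Σ_{a,b} W⁻¹` for the product weight `W = (1 + c₀A)(1 + c₁B₁)(1 + c₂B₂)` factorises into sums of this kind, one per space-time
direction; Benfatto–Giuliani–Mastropietro 2006, Lemma 2.2 at finite `(β, L)`: the decay volume of a single-scale propagator in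
lattice units).  With `x̃ = ZMod.valMinAbs x ∈ (-n/2, n/2]` the centred representative:

* `sum_range_inv_one_add_mul_sq_le` — `Σ_{m=1}^{K} (1 + (sm)²)⁻¹ ≤ π/(2s)` (antitone sum ≤ `∫_0^K (1+(sx)²)⁻¹ dx = arctan(sK)/s`);
* **`sum_zmod_inv_one_add_sq_valMinAbs_le`** — `Σ_{x ∈ ℤ/nℤ} (1 + (s|x̃|)²)⁻¹ ≤ 2 + π/s` for `s > 0` (each value of `|x̃|` is taken
  at most twice).  With `s = 4c/n` this is the `≲ n/c` of a weight `(1 + (4c|x̃|/n)²)⁻¹`.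

Everything is proved; no definitions, no named facts.

## Sources

G. Benfatto, A. Giuliani, V. Mastropietro, Ann. Henri Poincaré 7 (2006) 809–898, Lemma 2.2 and footnote ¹
(`BenfattoGiulianiMastropietro2006`); S. Friedli, Y. Velenik, *Statistical Mechanics of Lattice Systems* (2017), §10.4
(`FriedliVelenik2017`).
-/

noncomputable section

open Finset Real MeasureTheory intervalIntegral

namespace Literature.Probability.LatticeModels

/-- **The integer sum**: `Σ_{i < K} (1 + (s(i+1))²)⁻¹ ≤ π/(2s)` for `s > 0` (comparison of the antitone function
`x ↦ (1 + (sx)²)⁻¹` with its integral `∫_0^K = arctan(sK)/s ≤ π/(2s)`). [cite: FriedliVelenik2017, §10.4] -/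
theorem sum_range_inv_one_add_mul_sq_le {s : ℝ} (hs : 0 < s) (K : ℕ) :
    ∑ i ∈ range K, (1 + (s * ((i : ℝ) + 1)) ^ 2)⁻¹ ≤ Real.pi / (2 * s) := by
  set f : ℝ → ℝ := fun x => (1 + (s * x) ^ 2)⁻¹ with hf
  have hanti : AntitoneOn f (Set.Icc (0 : ℝ) (0 + K)) := by
    intro x hx y hy hxy
    simp only [hf]
    have hx0 : 0 ≤ x := hx.1
    have h1 : (s * x) ^ 2 ≤ (s * y) ^ 2 := by
      have : s * x ≤ s * y := mul_le_mul_of_nonneg_left hxy hs.le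
      exact pow_le_pow_left₀ (by positivity) this 2
    exact inv_anti₀ (by positivity) (by linarith)
  have hsum := AntitoneOn.sum_le_integral hanti
  simp only [hf, zero_add] at hsum
  have hcast : ∑ i ∈ range K, (1 + (s * ((i : ℝ) + 1)) ^ 2)⁻¹ = ∑ i ∈ range K, (1 + (s * ((i + 1 : ℕ) : ℝ)) ^ 2)⁻¹ := by
    refine sum_congr rfl fun i _ => ?_
    push_cast
    ring
  rw [hcast]
  refine hsum.trans ?_
  -- `∫_0^K (1 + (sx)²)⁻¹ dx = (arctan (sK) - arctan 0)/s ≤ π/(2s)`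
  have hint : ∫ x in (0 : ℝ)..(K : ℝ), (1 + (s * x) ^ 2)⁻¹ = s⁻¹ * (Real.arctan (s * K) - Real.arctan (s * 0)) := by
    have := intervalIntegral.integral_comp_mul_left (fun y : ℝ => (1 + y ^ 2)⁻¹) (c := s) hs.ne' (a := 0) (b := K)
    rw [this, smul_eq_mul]
    congr 1
    have h2 := integral_inv_one_add_sq (a := s * 0) (b := s * K)
    rw [← h2]
  rw [hint, mul_zero, Real.arctan_zero, sub_zero]
  have harc : Real.arctan (s * K) ≤ Real.pi / 2 := (Real.arctan_lt_pi_div_two _).le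
  rw [le_div_iff₀ (by positivity : (0 : ℝ) < 2 * s)]
  have : s⁻¹ * Real.arctan (s * K) * (2 * s) = 2 * Real.arctan (s * K) := by field_simp
  rw [this]
  linarith

/-- **The lattice sum on `ℤ/nℤ`**: `Σ_{x ∈ ℤ/nℤ} (1 + (s|x̃|)²)⁻¹ ≤ 2 + π/s` for `s > 0`, `x̃` the centred representative
(`ZMod.valMinAbs`): every value `k = |x̃|` is taken by at most two residues, and `Σ_{k ≥ 0} (1+(sk)²)⁻¹ ≤ 1 + π/(2s)`.
[cite: BenfattoGiulianiMastropietro2006, Lemma 2.2 and footnote 1] -/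
theorem sum_zmod_inv_one_add_sq_valMinAbs_le {n : ℕ} [NeZero n] {s : ℝ} (hs : 0 < s) :
    ∑ x : ZMod n, (1 + (s * |((x.valMinAbs : ℤ) : ℝ)|) ^ 2)⁻¹ ≤ 2 + Real.pi / s := by
  classical
  -- group the residues by `k = |x̃| ∈ {0, …, n/2}`
  set φ : ZMod n → ℕ := fun x => x.valMinAbs.natAbs with hφ
  set g : ℕ → ℝ := fun k => (1 + (s * (k : ℝ)) ^ 2)⁻¹ with hg
  have hg0 : ∀ k, 0 ≤ g k := fun k => by rw [hg]; positivity
  have hterm : ∀ x : ZMod n, (1 + (s * |((x.valMinAbs : ℤ) : ℝ)|) ^ 2)⁻¹ = g (φ x) := by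
    intro x
    simp only [hg, hφ, Nat.cast_natAbs, Int.cast_abs]
  simp_rw [hterm]
  set T : Finset ℕ := range (n / 2 + 1) with hT
  have hmaps : ∀ x ∈ (univ : Finset (ZMod n)), φ x ∈ T := fun x _ => by
    rw [hT, mem_range, Nat.lt_succ_iff]
    exact ZMod.natAbs_valMinAbs_le x
  rw [← sum_fiberwise_of_maps_to hmaps]
  -- each fibre has at most two elements
  have hfib : ∀ k ∈ T, ∑ x ∈ univ.filter (fun x : ZMod n => φ x = k), g (φ x) ≤ 2 * g k := by
    intro k _
    have hcard : ((univ.filter fun x : ZMod n => φ x = k).card : ℝ) ≤ 2 := by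
      have hinj : Set.InjOn (fun x : ZMod n => x.valMinAbs) (univ.filter fun x : ZMod n => φ x = k) :=
        fun x _ y _ hxy => ZMod.valMinAbs_inj.1 hxy
      have hmt : ∀ x ∈ univ.filter (fun x : ZMod n => φ x = k), x.valMinAbs ∈ ({(k : ℤ), -(k : ℤ)} : Finset ℤ) := by
        intro x hx
        have hk : x.valMinAbs.natAbs = k := (mem_filter.1 hx).2
        rw [mem_insert, mem_singleton]
        rcases Int.natAbs_eq x.valMinAbs with h | h
        · left; rw [h, hk]
        · right; rw [h, hk]
      have h := card_le_card_of_injOn _ hmt hinj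
      have h2 : (({(k : ℤ), -(k : ℤ)} : Finset ℤ).card) ≤ 2 := card_insert_le _ _
      exact_mod_cast h.trans h2
    calc ∑ x ∈ univ.filter (fun x : ZMod n => φ x = k), g (φ x)
        = ∑ x ∈ univ.filter (fun x : ZMod n => φ x = k), g k :=
          sum_congr rfl fun x hx => by rw [(mem_filter.1 hx).2]
      _ = (univ.filter fun x : ZMod n => φ x = k).card * g k := by rw [sum_const, nsmul_eq_mul]
      _ ≤ 2 * g k := mul_le_mul_of_nonneg_right hcard (hg0 k)
  refine (sum_le_sum hfib).trans ?_
  rw [← mul_sum, hT, sum_range_succ']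
  have h0 : g 0 = 1 := by simp only [hg, Nat.cast_zero, mul_zero]; norm_num
  have htail : ∑ i ∈ range (n / 2), g (i + 1) ≤ Real.pi / (2 * s) := by
    have := sum_range_inv_one_add_mul_sq_le hs (n / 2)
    refine le_trans (le_of_eq (sum_congr rfl fun i _ => ?_)) this
    simp only [hg, Nat.cast_add, Nat.cast_one]
  rw [h0]
  calc 2 * (∑ i ∈ range (n / 2), g (i + 1) + 1) ≤ 2 * (Real.pi / (2 * s) + 1) :=
        mul_le_mul_of_nonneg_left (add_le_add htail le_rfl) (by norm_num)
    _ = 2 + Real.pi / s := by field_simp; ring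

end Literature.Probability.LatticeModels

end
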